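import Mathlib
import HarnessLib
import Summits.HubbardSuperconductivity.HubbardSuperconductivity.Theses.ChiralWindow
import Summits.HubbardSuperconductivity.HubbardSuperconductivity.Theorems.ChiralWindowCwChannelInfContinuous
import Summits.HubbardSuperconductivity.HubbardSuperconductivity.Theorems.ChiralWindowCwChannelInfContinuousChemicalPotential
import Summits.HubbardSuperconductivity.HubbardSuperconductivity.Theorems.ChiralWindowCwChannelInfContinuousFilling
import Summits.HubbardSuperconductivity.HubbardSuperconductivity.Theorems.ChiralWindowCwThesisUFreeAnchor

/-!
# Crux `CwChiralConstruction` (stmt-HubbardSuperconductivity-1740), line `ladder-scale-transfer` rev c5-1: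
# stub (Kwin) `stub_klLeadingMuWindowOfPoint` — from `B₁g` leading at ONE window doping to a level window

Route `HubbardSuperconductivity/ChiralWindow`, rank-2 crux ("the programme"). Support file
(`--supports stmt-HubbardSuperconductivity-1740`), lead seat c5, 2026-08-17.

Write `ε₀ = squareDispersion 1 0`, `Λ_U(μ,χ) = channelInf ε₀ μ U χ` (bottom of the second-order pairing vertex
`⟨ψ, (U + U²χ₀)ψ⟩` over the normalised gap functions of the `D₄` irrep `χ` on the level-`μ` Fermi curve),
`μ(n) = chemicalPotentialOfDensity ε₀ n`, `n(μ) = KohnLuttinger.filling ε₀ μ`.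

The KL input of the line is the POINT datum (Kpt): `B₁g` leads every other channel by `γU²` at ONE window doping
`δ₀ ∈ [3/10, 12/25]` for all `U < U₁` (clause (i) of the kill switch `CwKLChiralWindow`, stmt-1741). This file turns the
point into a LEVEL WINDOW with certified free fillings, uniformly in small `U`:

* `klW_channelInf_scale_mono` — **the channel bottom divided by `U²` is antitone in `U`**:
  `(U/U')² Λ_{U'}(μ,χ) ≤ Λ_U(μ,χ)` for `0 < U ≤ U'`, `-4 < μ < 0`, every `χ` (the pairing form of a channel state is
  `U (∫ψ)² + U² Q(ψ)`, `kl_rl_pairingForm_sub`; the bare repulsion only grows relative to `U²` as `U ↓`). For `U' = 1`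
  this is the tree's `kl_rl_sq_channelInf_one_le`.
* `klW_leading_on_dopingWindow` — **from the point to a doping window**: (Kpt) at `δ₀` gives a `δ`-neighbourhood in
  `[1/4, 12/25]` on which `B₁g` leads by `(γ/2)U²` for all `U < min (U₁/2) (1/2)`: for `χ ∈ {A2g, B2g, E}` the bottoms are
  EXACTLY `U² Λ_1` (`CwThesis.channelInf_sq_of_ne_A1g`), so the datum at `U' = min (U₁/2) (1/2)` is a `U`-free strict
  inequality spread in `δ` by the continuity of `δ ↦ Λ_1(μ(1-δ), χ)` (support item stmt-1744 `CwChannelInfContinuous`,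
  PROVED: `cwChannelInfContinuous_proof`); for `A1g` the datum at `U'`, spread in `δ` by continuity at `U'`, propagates to
  every `U ≤ U'` by the antitone lemma.
* `stub_klLeadingMuWindowOfPoint` — **the registered stub**: the doping window is read as a level window
  `[μ₁, μ₂] = [μ(1-δ_hi), μ(1-δ_lo)]` through the continuous strictly increasing free filling
  (`chemicalPotentialOfDensity_spec`, `chemicalPotentialOfDensity_eq_of_filling_eq`, `monotone_filling`), with
  `13/25 < n(μ₁)`, `n(μ₂) < 7/10` by the choice of a one-sided sub-window of `[3/10, 12/25]`.

No definitions; everything is proved. References: S. Raghu, S. A. Kivelson, D. J. Scalapino, Phys. Rev. B 81 (2010)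
224505, §II (7), (13), §III Fig. 2; W. Kohn, J. M. Luttinger, Phys. Rev. Lett. 15 (1965) 524.
-/

noncomputable section

set_option linter.dupNamespace false

namespace Summit.HubbardSuperconductivity.HubbardSuperconductivity.Theorems

open MeasureTheory Set Filter Literature.MathematicalPhysics.QuantumLattice
open Summit.HubbardSuperconductivity.HubbardSuperconductivity.Theses.ChiralWindow
open scoped Topology

/-! ### The channel bottom over `U²` is antitone in `U` -/

/-- **`(U/U')² Λ_{U'}(μ,χ) ≤ Λ_U(μ,χ)` for `0 < U ≤ U'`** at a band level `-4 < μ < 0`: on a channel state `ψ` with mean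
`m = ∫ψ dσ`, `⟨ψ,Γ_Uψ⟩ = U²⟨ψ,Γ_1ψ⟩ + (U - U²)m²` (`kl_rl_pairingForm_sub`), so
`⟨ψ,Γ_Uψ⟩ - (U/U')²⟨ψ,Γ_{U'}ψ⟩ = U(1 - U/U') m² ≥ 0`; take infima (the `U'`-image is bounded below, `kl_rl_bddBelow`; the
state set is non-empty, `nonempty_isChannelState`). [cite: RaghuKivelsonScalapino2010, §II (7)] -/
theorem klW_channelInf_scale_mono {μ : ℝ} (hμ₁ : -4 < μ) (hμ₂ : μ < 0) {U U' : ℝ} (hU : 0 < U) (hUU' : U ≤ U')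
    (χ : D4Irrep) :
    (U / U') ^ 2 * channelInf (squareDispersion 1 0) μ U' χ ≤ channelInf (squareDispersion 1 0) μ U χ := by
  have hU'pos : 0 < U' := lt_of_lt_of_le hU hUU'
  unfold channelInf
  set S := {ψ | IsChannelState (squareDispersion 1 0) μ χ ψ} with hS
  have hne : (pairingForm (squareDispersion 1 0) μ U '' S).Nonempty :=
    (nonempty_isChannelState hμ₁ hμ₂ χ).image _
  have hbb : BddBelow (pairingForm (squareDispersion 1 0) μ U' '' S) := kl_rl_bddBelow hμ₁ hμ₂ U' χ
  refine le_csInf hne ?_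
  rintro _ ⟨ψ, hψ, rfl⟩
  have hinf : sInf (pairingForm (squareDispersion 1 0) μ U' '' S) ≤ pairingForm (squareDispersion 1 0) μ U' ψ :=
    csInf_le hbb ⟨ψ, hψ, rfl⟩
  -- the two expansions of the pairing form
  have eU := kl_rl_pairingForm_sub hμ₁ hμ₂ U hψ.1
  have eU' := kl_rl_pairingForm_sub hμ₁ hμ₂ U' hψ.1
  set m := ∫ k, ψ k ∂fermiCurveMeasure (squareDispersion 1 0) μ with hm
  set P1 := pairingForm (squareDispersion 1 0) μ 1 ψ with hP1
  have e1 : pairingForm (squareDispersion 1 0) μ U ψ = U ^ 2 * P1 + (U - U ^ 2) * m ^ 2 := by linarith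
  have e2 : pairingForm (squareDispersion 1 0) μ U' ψ = U' ^ 2 * P1 + (U' - U' ^ 2) * m ^ 2 := by linarith
  have key : (U / U') ^ 2 * pairingForm (squareDispersion 1 0) μ U' ψ ≤ pairingForm (squareDispersion 1 0) μ U ψ := by
    rw [e1, e2]
    have hU'ne : U' ≠ 0 := hU'pos.ne'
    have hexp : (U / U') ^ 2 * (U' ^ 2 * P1 + (U' - U' ^ 2) * m ^ 2) =
        U ^ 2 * P1 + (U ^ 2 / U' - U ^ 2) * m ^ 2 := by
      field_simp
    rw [hexp]
    have hcoef : U ^ 2 / U' ≤ U := by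
      rw [div_le_iff₀ hU'pos]
      nlinarith
    nlinarith [sq_nonneg m]
  calc (U / U') ^ 2 * sInf (pairingForm (squareDispersion 1 0) μ U' '' S)
      ≤ (U / U') ^ 2 * pairingForm (squareDispersion 1 0) μ U' ψ :=
        mul_le_mul_of_nonneg_left hinf (sq_nonneg _)
    _ ≤ pairingForm (squareDispersion 1 0) μ U ψ := key

/-! ### From the point to a doping window -/

/-- Uniform closeness from `ContinuousOn` at a point of the doping window: for `c > 0` there is `e > 0` with
`|f δ - f δ₀| ≤ c` whenever `δ ∈ [1/4, 12/25]` and `|δ - δ₀| ≤ e`. [folklore] -/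
theorem klW_close_of_continuousOn {f : ℝ → ℝ} (hf : ContinuousOn f (Icc (1 / 4 : ℝ) (12 / 25))) {δ₀ : ℝ}
    (hδ₀ : δ₀ ∈ Icc (1 / 4 : ℝ) (12 / 25)) {c : ℝ} (hc : 0 < c) :
    ∃ e : ℝ, 0 < e ∧ ∀ δ ∈ Icc (1 / 4 : ℝ) (12 / 25), |δ - δ₀| ≤ e → |f δ - f δ₀| ≤ c := by
  obtain ⟨e, he, h⟩ := Metric.continuousOn_iff.1 hf δ₀ hδ₀ c hc
  refine ⟨e / 2, by positivity, fun δ hδ hδe => ?_⟩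
  have hd : dist δ δ₀ < e := by
    rw [Real.dist_eq]
    linarith
  have := h δ hδ hd
  rw [Real.dist_eq] at this
  exact this.le

/-- **From `B₁g` leading at ONE window doping to a doping window, uniformly in small `U`.** If at
`μ₀ = μ(1-δ₀)`, `δ₀ ∈ [1/4, 12/25]`, `Λ_U(μ₀, B1g) + γU² ≤ Λ_U(μ₀, χ)` for every `χ ≠ B1g` and `U ∈ (0, U₁)`, then there is
`e > 0` such that for every `δ ∈ [1/4, 12/25]` with `|δ - δ₀| ≤ e`, every `U ∈ (0, min (U₁/2) (1/2))` and every `χ ≠ B1g`,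
`Λ_U(μ(1-δ), B1g) + (γ/2)U² ≤ Λ_U(μ(1-δ), χ)`. Non-`A1g` channels: exact `U²`-scaling + continuity at `U = 1`; `A1g`:
continuity at `U' = min (U₁/2) (1/2)` + the antitone lemma. [cite: RaghuKivelsonScalapino2010, §II (7), (13)] -/
theorem klW_leading_on_dopingWindow {δ₀ γ U₁ : ℝ} (hδ₀ : δ₀ ∈ Icc (1 / 4 : ℝ) (12 / 25)) (hγ : 0 < γ) (hU₁ : 0 < U₁)
    (hpt : ∀ U ∈ Ioo (0:ℝ) U₁, ∀ χ : D4Irrep, χ ≠ D4Irrep.B1g →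
      channelInf (squareDispersion 1 0) (chemicalPotentialOfDensity (squareDispersion 1 0) (1 - δ₀)) U D4Irrep.B1g
          + γ * U ^ 2 ≤
        channelInf (squareDispersion 1 0) (chemicalPotentialOfDensity (squareDispersion 1 0) (1 - δ₀)) U χ) :
    ∃ e : ℝ, 0 < e ∧ ∀ δ ∈ Icc (1 / 4 : ℝ) (12 / 25), |δ - δ₀| ≤ e →
      ∀ U ∈ Ioo (0:ℝ) (min (U₁ / 2) (1 / 2)), ∀ χ : D4Irrep, χ ≠ D4Irrep.B1g →
        channelInf (squareDispersion 1 0) (chemicalPotentialOfDensity (squareDispersion 1 0) (1 - δ)) U D4Irrep.B1g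
            + γ / 2 * U ^ 2 ≤
          channelInf (squareDispersion 1 0) (chemicalPotentialOfDensity (squareDispersion 1 0) (1 - δ)) U χ := by
  -- notation
  set μf : ℝ → ℝ := fun δ => chemicalPotentialOfDensity (squareDispersion 1 0) (1 - δ) with hμf
  set U' : ℝ := min (U₁ / 2) (1 / 2) with hU'
  have hU'pos : 0 < U' := lt_min (by positivity) (by norm_num)
  have hU'U₁ : U' < U₁ := lt_of_le_of_lt (min_le_left _ _) (by linarith)
  have hU'1 : U' ≤ 1 / 2 := min_le_right _ _
  have hcont := cwChannelInfContinuous_proof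
  -- the five continuous functions
  set fB : ℝ → ℝ := fun δ => channelInf (squareDispersion 1 0) (μf δ) 1 D4Irrep.B1g with hfB
  set fχ : D4Irrep → ℝ → ℝ := fun χ δ => channelInf (squareDispersion 1 0) (μf δ) 1 χ with hfχ
  set gA : ℝ → ℝ := fun δ => channelInf (squareDispersion 1 0) (μf δ) U' D4Irrep.A1g with hgA
  have hcB : ContinuousOn fB (Icc (1 / 4 : ℝ) (12 / 25)) := hcont 1 D4Irrep.B1g
  have hcχ : ∀ χ, ContinuousOn (fχ χ) (Icc (1 / 4 : ℝ) (12 / 25)) := fun χ => hcont 1 χ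
  have hcA : ContinuousOn gA (Icc (1 / 4 : ℝ) (12 / 25)) := hcont U' D4Irrep.A1g
  -- uniform closeness radii
  obtain ⟨eB, heB, hB⟩ := klW_close_of_continuousOn hcB hδ₀ (show (0:ℝ) < γ / 4 by positivity)
  have hχe : ∀ χ, ∃ e : ℝ, 0 < e ∧ ∀ δ ∈ Icc (1 / 4 : ℝ) (12 / 25), |δ - δ₀| ≤ e → |fχ χ δ - fχ χ δ₀| ≤ γ / 4 :=
    fun χ => klW_close_of_continuousOn (hcχ χ) hδ₀ (show (0:ℝ) < γ / 4 by positivity)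
  choose eχ heχ hχ using hχe
  obtain ⟨eA, heA, hA⟩ := klW_close_of_continuousOn hcA hδ₀ (show (0:ℝ) < γ * U' ^ 2 / 4 by positivity)
  -- the radius
  set e : ℝ := min (min eB eA) (min (min (eχ D4Irrep.A2g) (eχ D4Irrep.B2g)) (eχ D4Irrep.E)) with he
  have he0 : 0 < e := by
    rw [he]
    exact lt_min (lt_min heB heA) (lt_min (lt_min (heχ _) (heχ _)) (heχ _))
  have he_B : e ≤ eB := (min_le_left _ _).trans (min_le_left _ _)
  have he_A : e ≤ eA := (min_le_left _ _).trans (min_le_right _ _)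
  have he_A2g : e ≤ eχ D4Irrep.A2g := (min_le_right _ _).trans ((min_le_left _ _).trans (min_le_left _ _))
  have he_B2g : e ≤ eχ D4Irrep.B2g := (min_le_right _ _).trans ((min_le_left _ _).trans (min_le_right _ _))
  have he_E : e ≤ eχ D4Irrep.E := (min_le_right _ _).trans (min_le_right _ _)
  refine ⟨e, he0, fun δ hδ hδe U hU χ hχB => ?_⟩
  have hμδ : μf δ ∈ Ioo (-4 : ℝ) 0 := chemicalPotentialOfDensity_window_mem_Ioo hδ
  have hμ₀ : μf δ₀ ∈ Ioo (-4 : ℝ) 0 := chemicalPotentialOfDensity_window_mem_Ioo hδ₀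
  have hUpos : 0 < U := hU.1
  have hUU' : U < U' := hU.2
  -- the datum at `U'`
  have hptU' := hpt U' ⟨hU'pos, hU'U₁⟩
  -- `B1g` scales exactly
  have sB : ∀ (V : ℝ) (d : ℝ), d ∈ Icc (1 / 4 : ℝ) (12 / 25) →
      channelInf (squareDispersion 1 0) (μf d) V D4Irrep.B1g = V ^ 2 * fB d := fun V d hd =>
    CwThesis.channelInf_sq_of_ne_A1g (chemicalPotentialOfDensity_window_mem_Ioo hd) V (by decide)
  have hBclose := hB δ hδ (hδe.trans he_B)
  have hBabs := abs_le.1 hBclose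
  by_cases hχA : χ = D4Irrep.A1g
  · -- the `A1g` competitor: continuity at `U'` + antitone in `U`
    subst hχA
    have hdat : U' ^ 2 * fB δ₀ + γ * U' ^ 2 ≤ gA δ₀ := by
      have := hptU' D4Irrep.A1g (by decide)
      rwa [sB U' δ₀ hδ₀] at this
    have hAclose := abs_le.1 (hA δ hδ (hδe.trans he_A))
    have hwin : U' ^ 2 * fB δ + γ / 2 * U' ^ 2 ≤ gA δ := by
      have hU'2 : 0 ≤ U' ^ 2 := sq_nonneg _
      nlinarith [mul_le_mul_of_nonneg_left hBabs.2 hU'2]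
    have hmono := klW_channelInf_scale_mono hμδ.1 hμδ.2 hUpos hUU'.le D4Irrep.A1g
    -- `Λ_U(A1g) ≥ (U/U')² gA δ ≥ (U/U')² (U'² fB δ + γ/2 U'²) = U² fB δ + γ/2 U²`
    have hU'ne : U' ≠ 0 := hU'pos.ne'
    have hratio : (U / U') ^ 2 * (U' ^ 2 * fB δ + γ / 2 * U' ^ 2) = U ^ 2 * fB δ + γ / 2 * U ^ 2 := by
      field_simp
    have hstep : (U / U') ^ 2 * (U' ^ 2 * fB δ + γ / 2 * U' ^ 2) ≤ (U / U') ^ 2 * gA δ :=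
      mul_le_mul_of_nonneg_left hwin (sq_nonneg _)
    rw [sB U δ hδ]
    show U ^ 2 * fB δ + γ / 2 * U ^ 2 ≤ channelInf (squareDispersion 1 0) (μf δ) U D4Irrep.A1g
    linarith [hmono, hstep, hratio]
  · -- the exactly scaling competitors
    have sχ : ∀ (V : ℝ) (d : ℝ), d ∈ Icc (1 / 4 : ℝ) (12 / 25) →
        channelInf (squareDispersion 1 0) (μf d) V χ = V ^ 2 * fχ χ d := fun V d hd =>
      CwThesis.channelInf_sq_of_ne_A1g (chemicalPotentialOfDensity_window_mem_Ioo hd) V hχA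
    have hdat : fB δ₀ + γ ≤ fχ χ δ₀ := by
      have := hptU' χ hχB
      rw [sB U' δ₀ hδ₀, sχ U' δ₀ hδ₀] at this
      have hU'2 : 0 < U' ^ 2 := by positivity
      nlinarith
    have heχ' : e ≤ eχ χ := by
      cases χ with
      | A1g => exact absurd rfl hχA
      | B1g => exact absurd rfl hχB
      | A2g => exact he_A2g
      | B2g => exact he_B2g
      | E => exact he_E
    have hχclose := abs_le.1 (hχ χ δ hδ (hδe.trans heχ'))
    have hwin : fB δ + γ / 2 ≤ fχ χ δ := by linarith [hBabs.2, hχclose.1]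
    rw [sB U δ hδ, sχ U δ hδ]
    have hU2 : 0 ≤ U ^ 2 := sq_nonneg _
    nlinarith [mul_le_mul_of_nonneg_left hwin hU2]

/-! ### The registered stub: from the point to a level window with certified fillings -/

/-- **Stub (Kwin) `stub_klLeadingMuWindowOfPoint` of line `ladder-scale-transfer` (crux stmt-1740).** If `B₁g` leads every
other channel by `γU²` at ONE window doping `δ₀ ∈ [3/10, 12/25]` for all `U < U₁`, then there are band levels
`-4 < μ₁ < μ₂ < 0` with free fillings `13/25 < n(μ₁)`, `n(μ₂) < 7/10` and constants `γ', U₁' > 0` such that `B₁g` leads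
every other channel by `γ'U²` at every `μ ∈ [μ₁, μ₂]` and every `U ∈ (0, U₁')`. Proof: `klW_leading_on_dopingWindow` gives a
radius `e`; inside `[1/4,12/25] ∩ [δ₀ - e, δ₀ + e]` choose the one-sided closed sub-window
`[δ₀ + e'/2, δ₀ + e']` (`δ₀ ≤ 47/100`) or `[δ₀ - e', δ₀ - e'/2]` (`δ₀ > 47/100`), `e' = min e (1/200)`, whose fillings
`1 - δ` lie strictly inside `(13/25, 7/10)`; read it as the level window `[μ(1-δ_hi), μ(1-δ_lo)]` — every level in
between has its free filling in `[1-δ_hi, 1-δ_lo]` (`monotone_filling`) and IS `μ(its filling)`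
(`chemicalPotentialOfDensity_eq_of_filling_eq`). [cite: RaghuKivelsonScalapino2010, §III Fig. 2] -/
theorem stub_klLeadingMuWindowOfPoint :
    (∃ δ₀ ∈ Set.Icc (3/10 : ℝ) (12/25), ∃ γ U₁ : ℝ, 0 < γ ∧ 0 < U₁ ∧ ∀ U ∈ Set.Ioo (0:ℝ) U₁,
      ∀ χ : D4Irrep, χ ≠ D4Irrep.B1g →
        channelInf (squareDispersion 1 0) (chemicalPotentialOfDensity (squareDispersion 1 0) (1 - δ₀)) U D4Irrep.B1g
            + γ * U ^ 2 ≤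
          channelInf (squareDispersion 1 0) (chemicalPotentialOfDensity (squareDispersion 1 0) (1 - δ₀)) U χ) →
    ∃ μ₁ μ₂ γ U₁ : ℝ, -4 < μ₁ ∧ μ₁ < μ₂ ∧ μ₂ < 0 ∧ 0 < γ ∧ 0 < U₁ ∧
      13 / 25 < KohnLuttinger.filling (squareDispersion 1 0) μ₁ ∧
      KohnLuttinger.filling (squareDispersion 1 0) μ₂ < 7 / 10 ∧
      ∀ U ∈ Set.Ioo (0:ℝ) U₁, ∀ μ ∈ Set.Icc μ₁ μ₂, ∀ χ : D4Irrep, χ ≠ D4Irrep.B1g →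
        channelInf (squareDispersion 1 0) μ U D4Irrep.B1g + γ * U ^ 2 ≤ channelInf (squareDispersion 1 0) μ U χ := by
  rintro ⟨δ₀, hδ₀, γ, U₁, hγ, hU₁, hpt⟩
  have hδ₀w : δ₀ ∈ Icc (1 / 4 : ℝ) (12 / 25) := ⟨by linarith [hδ₀.1], hδ₀.2⟩
  obtain ⟨e, he, hwin⟩ := klW_leading_on_dopingWindow hδ₀w hγ hU₁ hpt
  -- the one-sided doping sub-window `[dlo, dhi]`
  set e' : ℝ := min e (1 / 200) with he'
  have he'0 : 0 < e' := lt_min he (by norm_num)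
  have he'e : e' ≤ e := min_le_left _ _
  have he'200 : e' ≤ 1 / 200 := min_le_right _ _
  obtain ⟨dlo, dhi, hlohi, hlo3, hhi48, hloW, hhiW, hclose⟩ :
      ∃ dlo dhi : ℝ, dlo < dhi ∧ 3 / 10 < dlo ∧ dhi < 12 / 25 ∧
        dlo ∈ Icc (1 / 4 : ℝ) (12 / 25) ∧ dhi ∈ Icc (1 / 4 : ℝ) (12 / 25) ∧
        ∀ d ∈ Icc dlo dhi, |d - δ₀| ≤ e := by
    by_cases h47 : δ₀ ≤ 47 / 100
    · refine ⟨δ₀ + e' / 2, δ₀ + e', by linarith, by linarith [hδ₀.1], by linarith,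
        ⟨by linarith [hδ₀.1], by linarith⟩, ⟨by linarith [hδ₀.1], by linarith⟩, fun d hd => ?_⟩
      rw [abs_le]; constructor <;> linarith [hd.1, hd.2]
    · have h47 : (47 : ℝ) / 100 < δ₀ := not_le.mp h47
      refine ⟨δ₀ - e', δ₀ - e' / 2, by linarith, by linarith, by linarith [hδ₀.2],
        ⟨by linarith, by linarith [hδ₀.2]⟩, ⟨by linarith, by linarith [hδ₀.2]⟩, fun d hd => ?_⟩
      rw [abs_le]; constructor <;> linarith [hd.1, hd.2]
  -- the level window
  set μf : ℝ → ℝ := fun δ => chemicalPotentialOfDensity (squareDispersion 1 0) (1 - δ) with hμf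
  have spec : ∀ d ∈ Icc (1 / 4 : ℝ) (12 / 25), μf d ∈ Ioo (-4 : ℝ) 0 ∧
      KohnLuttinger.filling (squareDispersion 1 0) (μf d) = 1 - d := fun d hd =>
    chemicalPotentialOfDensity_spec (one_sub_mem_Ioo_of_mem_window hd).1 (one_sub_mem_Ioo_of_mem_window hd).2
  obtain ⟨hμ₁I, hn₁⟩ := spec dhi hhiW
  obtain ⟨hμ₂I, hn₂⟩ := spec dlo hloW
  have h12 : μf dhi < μf dlo := by
    by_contra hle
    have hle : μf dlo ≤ μf dhi := not_lt.mp hle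
    have := monotone_filling hle
    rw [hn₁, hn₂] at this
    linarith
  refine ⟨μf dhi, μf dlo, γ / 2, min (U₁ / 2) (1 / 2), hμ₁I.1, h12, hμ₂I.2, by positivity,
    lt_min (by positivity) (by norm_num), by rw [hn₁]; linarith, by rw [hn₂]; linarith, fun U hU μ hμ χ hχ => ?_⟩
  -- the level `μ` is `μ(1 - d)` for `d = 1 - n(μ) ∈ [dlo, dhi]`
  set n := KohnLuttinger.filling (squareDispersion 1 0) μ with hn
  have hnlo : 1 - dhi ≤ n := by rw [← hn₁]; exact monotone_filling hμ.1
  have hnhi : n ≤ 1 - dlo := by rw [← hn₂]; exact monotone_filling hμ.2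
  have hdW : 1 - n ∈ Icc (1 / 4 : ℝ) (12 / 25) := ⟨by linarith [hloW.1], by linarith [hhiW.2]⟩
  have hdclose : |1 - n - δ₀| ≤ e := hclose (1 - n) ⟨by linarith, by linarith⟩
  have hμeq : chemicalPotentialOfDensity (squareDispersion 1 0) (1 - (1 - n)) = μ := by
    rw [sub_sub_cancel]
    exact chemicalPotentialOfDensity_eq_of_filling_eq (by linarith)
      ⟨by linarith [hμ₁I.1, hμ.1], by linarith [hμ₂I.2, hμ.2]⟩ rfl
  have := hwin (1 - n) hdW hdclose U hU χ hχ
  rwa [hμeq] at this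

end Summit.HubbardSuperconductivity.HubbardSuperconductivity.Theorems

end
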